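import Literature.Computability.QuantumComplexity.StabilizerSimulationSparsification
import Literature.Computability.QuantumComplexity.StabilizerSimulationProofs
import Literature.Computability.QuantumComplexity.CliffordSimulator
import HarnessLib

/-!
# The approximate stabilizer rank of `|T⟩^{⊗m}` (Bravyi et al. 2019, eq. (6))

Topic `Literature/Computability/QuantumComplexity`. This file discharges the named fact
`BravyiEtAl2019_approxStabilizerRank_magicT_pow` of `StabilizerSimulation.lean`:

* `BravyiEtAl2019_approxStabilizerRank_magicT_pow_holds` —
  `χ_δ(|T⟩^{⊗m}) ≤ 1 + cos(π/8)^{-2m} / δ²` for all `m` and `δ > 0` (Bravyi et al. 2019,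
  eq. (6) and §5.3; Bravyi–Gosset 2016, eq. (4)): the sparsification bound (Theorem 1, the
  tree's `BravyiEtAl2019_thm1`, discharged in `StabilizerSimulationSparsification.lean`)
  applied to the `2^m`-term decomposition of `|T⟩^{⊗m}` into tensor products of `|+⟩ = H|0⟩`
  and `|+i⟩ = S H|0⟩`, whose `ℓ¹`-norm is `‖c‖₁ = cos(π/8)^{-m}` (the optimal one,
  `‖c‖₁² = ξ(T^{⊗m}) = F(T^{⊗m})⁻¹`, §5.3 and Prop. 2 — optimality is not needed here).

## Proof architecture (all proved here, over the tree's operational definitions)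

* `magicT_eq_smul_add_smul`: `|T⟩ = (ω/(1+ω)) |+⟩ + (1/(1+ω)) |+i⟩` with `ω = e^{iπ/4}` — this
  is eq. (37) of §5.3 for the Clifford magic state `|T⟩` with stabilizer group `{1, T X T†}`,
  `|T⟩ = (2⟨T|+⟩)⁻¹ (1 + T X T†)|+⟩`, `T X T† = ω⁻¹ S X` — checked amplitude-wise from
  `ω² = i`; `|+⟩`, `|+i⟩` are stabilizer states of norm one (`H`, `S` on the single wire are
  Clifford circuits, `placeGate_wireEmb_fin_one`);
* `norm_coeff_magicT_sq`: both coefficients have modulus `1/|1+ω|`, and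
  `(2/|1+ω|)² = 4/(2+√2) = 1/cos²(π/8)` (`cos²(π/8) = (1 + cos(π/4))/2`);
* `exists_decomposition_tensorPow`: stabilizer decompositions of a one-qubit state tensorize
  (§5.1: tensor products of stabilizer states are stabilizer states, bilinearity), with
  multiplicative `ℓ¹`-norm and normalized product states (`normSq_tensorVec`), so
  `|T⟩^{⊗m}` has a decomposition with `‖c‖₁² = cos(π/8)^{-2m}`;
* Theorem 1 (`BravyiEtAl2019_thm1_holds`, after reindexing the product basis by
  `Fin (2^m)` and with `‖|T⟩^{⊗m}‖ = 1`, `normSq_tensorPow`) finishes.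

Tree reuse: `BravyiEtAl2019_thm1_holds` (`StabilizerSimulationSparsification.lean`),
`tensorVec_mem_stabilizerStates`, `tensorVec_apply` (`StabilizerSimulationProofs.lean`),
`CliffordSim.magicT_apply`, `CliffordSim.hGate_mulVec_zeroState` (`CliffordSimulator.lean`),
`omega_pow_two`, `omega_re`, `omega_im`, `invSqrt2`, `wireEmb`, `sum_qReg_one`,
`mulVec_mem_stabilizerStates`, `tensorPow_zero_eq_zeroState`; Mathlib: `Fin.appendEquiv`,
`Fintype.sum_prod_type`, `Equiv.sum_comp`, `Real.cos_sq`, `Real.cos_pi_div_four`,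
`Complex.norm_exp_ofReal_mul_I`. No definitions and no named facts are introduced.

## References

* S. Bravyi, D. Browne, P. Calpin, E. Campbell, D. Gosset, M. Howard, *Simulation of quantum
  circuits by low-rank stabilizer decompositions*, Quantum 3 (2019) 181, arXiv:1808.00128:
  Thm. 1 (p. 5), eq. (6) (p. 8), §5.1 (products of stabilizer decompositions), §5.3 (Clifford
  magic states; `F(T^{⊗n})^{-1} = |⟨+|T⟩|^{-2n}`, p. 23).
* S. Bravyi, D. Gosset, *Improved classical simulation of quantum circuits dominated by Clifford
  gates*, Phys. Rev. Lett. 116 (2016) 250501, arXiv:1601.07601: eq. (4)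
  (`χ_δ(T^{⊗t}) = O(2^{γt} δ^{-2})`, `γ = -2 log₂ cos(π/8)`).
-/

noncomputable section

namespace Literature.Computability.QuantumComplexity

open Cryptography Matrix

/-! ### Tensor products: norms, bilinearity, tensor powers of a decomposition -/

/-- **The norm is multiplicative on tensor products**: `‖ψ ⊗ φ‖² = ‖ψ‖² ‖φ‖²` (reindex the
basis labels of `a + b` wires as pairs, `Fin.appendEquiv`). [Nielsen–Chuang 2010, §2.1.7]
[folklore] -/
theorem normSq_tensorVec {a b : ℕ} (ψ : QReg a → ℂ) (φ : QReg b → ℂ) :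
    normSq (tensorVec ψ φ) = normSq ψ * normSq φ := by
  calc normSq (tensorVec ψ φ)
      = ∑ q : QReg a × QReg b, ‖tensorVec ψ φ (Fin.appendEquiv a b q)‖ ^ 2 :=
        ((Fin.appendEquiv a b).sum_comp (fun z => ‖tensorVec ψ φ z‖ ^ 2)).symm
    _ = ∑ q : QReg a × QReg b, ‖ψ q.1‖ ^ 2 * ‖φ q.2‖ ^ 2 :=
        Fintype.sum_congr _ _ fun q => by
          simp [tensorVec_apply, Fin.appendEquiv, mul_pow]
    _ = normSq ψ * normSq φ := by
        rw [Fintype.sum_prod_type]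
        unfold normSq
        rw [Finset.sum_mul_sum]

/-- `‖ψ^{⊗m}‖² = (‖ψ‖²)^m`. [folklore] -/
theorem normSq_tensorPow (ψ : QReg 1 → ℂ) (m : ℕ) : normSq (tensorPow ψ m) = normSq ψ ^ m := by
  induction m with
  | zero =>
    rw [tensorPow_zero_eq_zeroState, pow_zero]
    exact normSq_basisState _
  | succ m ih =>
    show normSq (tensorVec (tensorPow ψ m) ψ) = _
    rw [normSq_tensorVec, ih, pow_succ]

/-- **Bilinearity of the tensor product** over arbitrary finite index types (the tree's
`tensorVec_sum_smul` is the `Fin`-indexed case). [Nielsen–Chuang 2010, §2.1.7] [folklore] -/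
theorem tensorVec_fintype_sum_smul {a b : ℕ} {ι κ : Type*} [Fintype ι] [Fintype κ] (c : ι → ℂ)
    (ψ : ι → QReg a → ℂ) (d : κ → ℂ) (φ : κ → QReg b → ℂ) :
    tensorVec (∑ i, c i • ψ i) (∑ j, d j • φ j) = ∑ i, ∑ j, (c i * d j) • tensorVec (ψ i) (φ j) := by
  funext z
  simp only [tensorVec_apply, Finset.sum_apply, Pi.smul_apply, smul_eq_mul]
  rw [Finset.sum_mul_sum]
  refine Finset.sum_congr rfl fun i _ => Finset.sum_congr rfl fun j _ => ?_
  ring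

/-- **Tensor powers of a decomposed one-qubit state**: if `ψ = ∑_b d_b σ_b` with normalized
stabilizer states `σ_b`, then `ψ^{⊗m}` is the combination of the `|κ|^m` normalized stabilizer
product states `σ_{b_1} ⊗ ⋯ ⊗ σ_{b_m}` with coefficients `∏ d_{b_j}`, whose `ℓ¹`-norm is
`(∑_b |d_b|)^m` (Bravyi et al. 2019, §5.1: products of stabilizer decompositions, the easy
half of the multiplicativity of `ξ`, Prop. 1). The index set is returned abstractly.
[cite: BravyiEtAl2019, §5.1] -/
theorem exists_decomposition_tensorPow {κ : Type} [Fintype κ] (ψ : QReg 1 → ℂ) (d : κ → ℂ)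
    (σ : κ → QReg 1 → ℂ) (hσ : ∀ b, σ b ∈ stabilizerStates 1) (hσ₁ : ∀ b, normSq (σ b) = 1)
    (hψ : ψ = ∑ b, d b • σ b) (m : ℕ) :
    ∃ (ι : Type) (_ : Fintype ι) (c : ι → ℂ) (Φ : ι → QReg m → ℂ),
      (∀ i, Φ i ∈ stabilizerStates m) ∧ (∀ i, normSq (Φ i) = 1) ∧
        tensorPow ψ m = ∑ i, c i • Φ i ∧ ∑ i, ‖c i‖ = (∑ b, ‖d b‖) ^ m := by
  induction m with
  | zero =>
    refine ⟨Unit, inferInstance, fun _ => 1, fun _ => zeroState 0,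
      fun _ => zeroState_mem_stabilizerStates 0, fun _ => normSq_basisState _, ?_, by simp⟩
    rw [tensorPow_zero_eq_zeroState]
    simp
  | succ m ih =>
    obtain ⟨ι, _, c, Φ, hΦ, hΦ₁, hdec, hsum⟩ := ih
    refine ⟨ι × κ, inferInstance, fun q => c q.1 * d q.2, fun q => tensorVec (Φ q.1) (σ q.2),
      fun q => tensorVec_mem_stabilizerStates (hΦ q.1) (hσ q.2),
      fun q => by rw [normSq_tensorVec, hΦ₁, hσ₁, one_mul], ?_, ?_⟩
    · show tensorVec (tensorPow ψ m) ψ = _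
      rw [hdec, Fintype.sum_prod_type]
      conv_lhs => rw [hψ]
      exact tensorVec_fintype_sum_smul c Φ d σ
    · rw [Fintype.sum_prod_type]
      simp only [norm_mul]
      rw [← Finset.sum_mul_sum, hsum, pow_succ]

/-! ### The magic state `|T⟩` over `|+⟩` and `|+i⟩` -/

/-- On one wire, placing a one-qubit gate on the (only) wire is the gate itself. [folklore] -/
theorem placeGate_wireEmb_fin_one (U : Matrix (QReg 1) (QReg 1) ℂ) :
    placeGate (wireEmb (0 : Fin 1)) U = U := by
  ext x y
  have hx : (x ∘ wireEmb (0 : Fin 1)) = x := funext fun j => by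
    rw [Function.comp_apply, wireEmb_apply, Subsingleton.elim 0 j]
  have hy : (y ∘ wireEmb (0 : Fin 1)) = y := funext fun j => by
    rw [Function.comp_apply, wireEmb_apply, Subsingleton.elim 0 j]
  rw [placeGate_apply, if_pos fun i hi => absurd (by simp [Subsingleton.elim i 0]) hi, hx, hy]

/-- The Hadamard gate on one wire is a Clifford circuit. [Aaronson–Gottesman 2004, §I]
[folklore] -/
theorem hGate_mem_cliffordCircuits : hGate ∈ cliffordCircuits 1 := by
  have h : placeGate (wireEmb (0 : Fin 1)) hGate ∈ cliffordCircuits 1 :=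
    Submonoid.subset_closure ⟨CliffordOp.H, wireEmb 0, rfl⟩
  rwa [placeGate_wireEmb_fin_one] at h

/-- The phase gate on one wire is a Clifford circuit. [Aaronson–Gottesman 2004, §I]
[folklore] -/
theorem sGate_mem_cliffordCircuits : sGate ∈ cliffordCircuits 1 := by
  have h : placeGate (wireEmb (0 : Fin 1)) sGate ∈ cliffordCircuits 1 :=
    Submonoid.subset_closure ⟨CliffordOp.S, wireEmb 0, rfl⟩
  rwa [placeGate_wireEmb_fin_one] at h

/-- `|+⟩ = H|0⟩` is a stabilizer state. [Aaronson–Gottesman 2004, §I] [folklore] -/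
theorem plusState_mem_stabilizerStates : hGate *ᵥ zeroState 1 ∈ stabilizerStates 1 :=
  mulVec_mem_stabilizerStates hGate_mem_cliffordCircuits (zeroState_mem_stabilizerStates 1)

/-- `|+i⟩ = S H|0⟩` is a stabilizer state. [Aaronson–Gottesman 2004, §I] [folklore] -/
theorem plusIState_mem_stabilizerStates :
    sGate *ᵥ (hGate *ᵥ zeroState 1) ∈ stabilizerStates 1 :=
  mulVec_mem_stabilizerStates sGate_mem_cliffordCircuits plusState_mem_stabilizerStates

/-- The phase gate acts diagonally: `(S v)(y) = i^{y} v(y)`. [Nielsen–Chuang 2010, §4.2]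
[folklore] -/
theorem sGate_mulVec_apply (v : QReg 1 → ℂ) (y : QReg 1) :
    (sGate *ᵥ v) y = (if y 0 = true then Complex.I else 1) * v y := by
  simp only [Matrix.mulVec, dotProduct]
  rw [Finset.sum_eq_single y]
  · simp [sGate]
  · intro j _ hj
    simp [sGate, Ne.symm hj]
  · simp

/-- `‖|+⟩‖² = 1`: two amplitudes `1/√2`. [Nielsen–Chuang 2010, §1.3.1] [folklore] -/
theorem normSq_plusState : normSq (hGate *ᵥ zeroState 1) = 1 := by
  have hns : ‖(invSqrt2 : ℂ)‖ ^ 2 = 1 / 2 := by simp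
  rw [CliffordSim.hGate_mulVec_zeroState]
  simp only [normSq, sum_qReg_one, Fintype.sum_bool, hns]
  norm_num

/-- `‖|+i⟩‖² = 1`: amplitudes `1/√2` and `i/√2`. [Nielsen–Chuang 2010, §4.2] [folklore] -/
theorem normSq_plusIState : normSq (sGate *ᵥ (hGate *ᵥ zeroState 1)) = 1 := by
  have hns : ‖(invSqrt2 : ℂ)‖ ^ 2 = 1 / 2 := by simp
  simp only [normSq, sum_qReg_one, Fintype.sum_bool, sGate_mulVec_apply,
    CliffordSim.hGate_mulVec_zeroState, if_true, Bool.false_eq_true, if_false, one_mul, norm_mul,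
    Complex.norm_I, mul_pow, one_pow, hns]
  norm_num

/-- `|ω| = 1`. [folklore] -/
theorem norm_omega_eq_one : ‖(omega : ℂ)‖ = 1 := by
  have h : omega = Complex.exp (((Real.pi / 4 : ℝ) : ℂ) * Complex.I) := by
    simp only [omega]
    push_cast
    ring_nf
  rw [h, Complex.norm_exp_ofReal_mul_I]

/-- `‖|T⟩‖² = 1`: amplitudes `1/√2` and `ω/√2`. [Bravyi–Gosset 2016, eq. (2)] [folklore] -/
theorem normSq_magicT : normSq magicT = 1 := by
  have hns : ‖(invSqrt2 : ℂ)‖ ^ 2 = 1 / 2 := by simp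
  simp only [normSq, sum_qReg_one, Fintype.sum_bool, CliffordSim.magicT_apply, if_true,
    Bool.false_eq_true, if_false, mul_one, norm_mul, norm_omega_eq_one, mul_pow, one_pow, hns]
  norm_num

/-- `1 + ω ≠ 0` (`Re (1 + ω) = 1 + √2/2 > 0`). [folklore] -/
theorem one_add_omega_ne_zero : (1 + omega : ℂ) ≠ 0 := by
  intro h
  have hre : (1 + omega : ℂ).re = 1 + Real.sqrt 2 / 2 := by
    rw [Complex.add_re, Complex.one_re, omega_re]
  rw [h, Complex.zero_re] at hre
  have := Real.sqrt_nonneg 2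
  linarith

/-- `|1 + ω|² = 2 + √2` (`= 4 cos²(π/8)`). [folklore] -/
theorem norm_one_add_omega_sq : ‖(1 + omega : ℂ)‖ ^ 2 = 2 + Real.sqrt 2 := by
  rw [Complex.sq_norm, Complex.normSq_apply, Complex.add_re, Complex.one_re, omega_re,
    Complex.add_im, Complex.one_im, omega_im]
  have hs : Real.sqrt 2 * Real.sqrt 2 = 2 := Real.mul_self_sqrt (by norm_num)
  linear_combination (1 / 2 : ℝ) * hs

/-- **The two-term stabilizer decomposition of the magic state**:
`|T⟩ = (ω/(1+ω)) |+⟩ + (1/(1+ω)) |+i⟩` with `|+⟩ = H|0⟩`, `|+i⟩ = S|+⟩ = (|0⟩ + i|1⟩)/√2`,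
`ω = e^{iπ/4}` — i.e. `|T⟩ = (2⟨T|+⟩)⁻¹ (|+⟩ + T X T† |+⟩)` with `T X T† = ω⁻¹ S X`
(Bravyi et al. 2019, §5.3 eq. (37) for the Clifford magic state `|T⟩`, stabilizer group
`{1, T X T†}`). Checked amplitude-wise using `ω² = i`. [cite: BravyiEtAl2019, §5.3] -/
theorem magicT_eq_smul_add_smul :
    magicT = (omega / (1 + omega)) • (hGate *ᵥ zeroState 1) +
      (1 / (1 + omega)) • (sGate *ᵥ (hGate *ᵥ zeroState 1)) := by
  have hab : omega / (1 + omega) + 1 / (1 + omega) = 1 := by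
    rw [← add_div, add_comm, div_self one_add_omega_ne_zero]
  have habI : omega / (1 + omega) + 1 / (1 + omega) * Complex.I = omega := by
    rw [div_mul_eq_mul_div, one_mul, ← add_div, div_eq_iff one_add_omega_ne_zero, mul_add,
      mul_one, ← sq, omega_pow_two]
  funext y
  rw [CliffordSim.magicT_apply]
  simp only [Pi.add_apply, Pi.smul_apply, smul_eq_mul, sGate_mulVec_apply,
    CliffordSim.hGate_mulVec_zeroState]
  by_cases hy : y 0 = true
  · simp only [hy, if_true]
    linear_combination (-invSqrt2) * habI
  · simp only [hy, Bool.false_eq_true, if_false]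
    linear_combination (-invSqrt2) * hab

/-- The squared `ℓ¹`-norm of the two coefficients is `cos(π/8)^{-2}`:
`(|ω/(1+ω)| + |1/(1+ω)|)² = 4/|1+ω|² = 4/(2+√2) = 1/cos²(π/8)` (`cos²(π/8) = (1 + cos(π/4))/2`).
This is `ξ(T) = F(T)^{-1} = |⟨+|T⟩|^{-2}` of Bravyi et al. 2019, §5.3.
[cite: BravyiEtAl2019, §5.3] -/
theorem norm_coeff_magicT_sq :
    (‖omega / (1 + omega)‖ + ‖(1 : ℂ) / (1 + omega)‖) ^ 2 = (Real.cos (Real.pi / 8) ^ 2)⁻¹ := by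
  have hm : ‖(1 + omega : ℂ)‖ ^ 2 = 2 + Real.sqrt 2 := norm_one_add_omega_sq
  have hcos : Real.cos (Real.pi / 8) ^ 2 = (2 + Real.sqrt 2) / 4 := by
    rw [Real.cos_sq, show (2 : ℝ) * (Real.pi / 8) = Real.pi / 4 by ring, Real.cos_pi_div_four]
    ring
  rw [norm_div, norm_div, norm_omega_eq_one, norm_one, ← add_div, div_pow, hm, hcos, inv_div]
  norm_num

/-! ### Discharge of `BravyiEtAl2019_approxStabilizerRank_magicT_pow` -/

/-- **Discharge of `BravyiEtAl2019_approxStabilizerRank_magicT_pow`**: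
`χ_δ(|T⟩^{⊗m}) ≤ 1 + cos(π/8)^{-2m}/δ²` for all `m` and `δ > 0` — Theorem 1
(`BravyiEtAl2019_thm1_holds`) applied to the `2^m`-term decomposition of the unit vector
`|T⟩^{⊗m}` into products of `|+⟩`, `|+i⟩` (`exists_decomposition_tensorPow` with
`magicT_eq_smul_add_smul`, reindexed by `Fin (2^m)`), whose `ℓ¹`-norm squared is
`cos(π/8)^{-2m}` (`norm_coeff_magicT_sq`). Printed as eq. (6),
`χ_δ(T^{⊗m}) ≤ O(δ^{-2} cos(π/8)^{-2m})` (Bravyi et al. 2019, via Thm. 1, Prop. 2 and §5.3),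
resp. `O(2^{γt} δ^{-2})`, `γ = -2 log₂ cos(π/8)` (Bravyi–Gosset 2016, eq. (4)).
[cite: BravyiEtAl2019, Thm. 1, eq. (6) and §5.3] -/
theorem BravyiEtAl2019_approxStabilizerRank_magicT_pow_holds :
    BravyiEtAl2019_approxStabilizerRank_magicT_pow := by
  intro m δ hδ
  -- the one-qubit decomposition, indexed by `Fin 2`
  have h1 : magicT = ∑ b : Fin 2, ![omega / (1 + omega), 1 / (1 + omega)] b •
      ![hGate *ᵥ zeroState 1, sGate *ᵥ (hGate *ᵥ zeroState 1)] b := by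
    rw [Fin.sum_univ_two]
    simpa using magicT_eq_smul_add_smul
  have hσ : ∀ b : Fin 2, ![hGate *ᵥ zeroState 1, sGate *ᵥ (hGate *ᵥ zeroState 1)] b ∈
      stabilizerStates 1 := by
    intro b
    fin_cases b
    · exact plusState_mem_stabilizerStates
    · exact plusIState_mem_stabilizerStates
  have hσ₁ : ∀ b : Fin 2,
      normSq (![hGate *ᵥ zeroState 1, sGate *ᵥ (hGate *ᵥ zeroState 1)] b) = 1 := by
    intro b
    fin_cases b
    · exact normSq_plusState
    · exact normSq_plusIState
  have hd : ∑ b : Fin 2, ‖![omega / (1 + omega), 1 / (1 + omega)] b‖ =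
      ‖omega / (1 + omega)‖ + ‖(1 : ℂ) / (1 + omega)‖ := by
    rw [Fin.sum_univ_two]
    simp
  -- the product decomposition of `|T⟩^{⊗m}`, reindexed by `Fin _`
  obtain ⟨ι, _, c, Φ, hΦ, hΦ₁, hdec, hsum⟩ := exists_decomposition_tensorPow magicT _ _ hσ hσ₁ h1 m
  set e := (Fintype.equivFin ι).symm with he
  have hdec' : tensorPow magicT m = ∑ j : Fin (Fintype.card ι), c (e j) • Φ (e j) := by
    rw [hdec]
    exact (e.sum_comp (fun i => c i • Φ i)).symm
  have hsum' : ∑ j : Fin (Fintype.card ι), ‖c (e j)‖ = ∑ i, ‖c i‖ := e.sum_comp (fun i => ‖c i‖)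
  have hunit : normSq (tensorPow magicT m) = 1 := by
    rw [normSq_tensorPow, normSq_magicT, one_pow]
  -- Theorem 1
  have h := BravyiEtAl2019_thm1_holds (tensorPow magicT m) hunit (fun j => c (e j))
    (fun j => Φ (e j)) (fun j => hΦ (e j)) (fun j => hΦ₁ (e j)) hdec' δ hδ
  rw [hsum', hsum, hd, ← pow_mul, mul_comm m 2, pow_mul, norm_coeff_magicT_sq, inv_pow,
    ← pow_mul, div_eq_mul_inv, ← mul_inv, ← one_div] at h
  exact h

end Literature.Computability.QuantumComplexity
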